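import Summits.Ventures.CertifiedArithmetic.LowPrec.GemmEnvelopeOnset

/-!
# GEMM-level envelopes, part (y): THE ONSET LAW FOR CELL PAIRS — absorption and the E4M3 two-rung trichotomy (pub-lowprec gemm gen 24, LXXII-a)

HONEST FRAMING: certified error envelopes and provably optimal rounding/accumulation schemes for
low-precision formats under stated cost models; every table by two implementations; no hardware or vendor
claims.

Part (u) `GemmEnvelopeOnset` decides a kind-(v) row at the OUTPUT of the pipeline
`c = post(acc(ΣΣ q̂a·q̂b))` (`|acc - ΣΣ q̂a q̂b| ≤ γ·ΣΣ|q̂a q̂b|`, `γ ≤ γ̄`; `|c - acc| ≤ δ·|acc|`, `δ ≤ δ̄`) from a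
PER-CELL ratio band `q̂a q̂b = r·(a b)`, `r ∈ [r_lo, r_hi]`.  For MX blocks of LENGTH 2 no per-cell band is
sharp: in an ALIGNED block pair (both maxima in the same position) the other cell may be a sliver·sliver cell
with ratio up to `R²`, but its exact value is at most `1/14336²` of the max·max cell and it is ABSORBED by that
cell's slack.  This file supplies the record-generic tools and the E4M3 element facts for that argument;
parts (z) `GemmEnvelopeOnsetTwoBand` (no-witness half, lengths 2 and 1) and (aa) `GemmEnvelopeOnsetTwo` (witness half)
assemble the row-P5 onset law for blocks of length 2: onset EXACTLY `onset₂ = 608995584/34799 ≈ 17500.376`.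

* `realisation_of_brackets`, `no_output_witness_of_block_bounds`: the explicit admissible realisation of
  part (u), now from the two SUMMED bracket inequalities per block (any grouping of cells may share slack).
* `small_cell_bounds`, `absorb_cell_bounds`: a cell `p' = r'·s'`, `0 ≤ r' ≤ R'`, `|s'| ≤ ε|s|` rides on a banded
  cell `p = r·s`, `r ∈ [r_lo, r_hi]`, at the cost of the slack `(1 + R')·ε` in both onset conditions.
* `toRat_roundNE_E4M3_eq_7_512` (`(13/1024, 15/1024) ↦ 7/512`), `toRat_roundNE_E4M3_eq_inv64'`
  (`[15/1024, 1/64] ↦ 1/64`, the tie `15/1024` goes to the even neighbour): the two sliver rungs.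
* `mxCeil_normal_or_small` (no class hypothesis): every MX-E4M3-ceil element is `ρ·v`, `|ρ - 1| ≤ 1/17`, or a
  nonzero sliver element with `14336·|v| < blockMax V`; `mxCeil_ratio_of_max`: an element of maximal modulus is
  of the first kind; `mxCeil_ratio_band_two_rungs`: on `C(κ)`, `κ ≤ 229376/13`, every element is `ρ·v` with
  `ρ_lo ≤ ρ ≤ R` for `0 ≤ ρ_lo ≤ 16/17` (`ρ_lo ≤ 14/15` once `κ > 229376/15`), `R ≥ 18/17`,
  `R ≥ min(κ/14336, 16/15)`, `R ≥ κ/16384` (rung 1: `X/64`, ratio `< κ/14336`, `≤ 16/15`; rung 2: `7X/512`,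
  ratio in `(14/15, κ/16384)`, reachable only for `κ > 229376/15`).

Exact rational algebra over the kernel definitions `roundNE`, `ceilScale`, `blockMax`; caps are hypotheses,
not device claims.  No `sorry`; axioms `propext`, `Classical.choice`, `Quot.sound` only.
[cite: RouhaniEtAl2023MX, §5.1] [cite: MicikeviciusEtAl2022, §3] [cite: Higham2002ASNA, §3.1]
-/

namespace Summit.Ventures.CertifiedArithmetic.LowPrec.GemmEnvelope

open Finset
open Literature.ComputerArithmetic.FloatingPoint
open Literature.ComputerArithmetic.FloatingPoint.Format
open Literature.ComputerArithmetic.FloatingPoint.MiniFloat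
open Literature.ComputerArithmetic.FloatingPoint.MXBlock
open Summit.Ventures.CertifiedArithmetic.LowPrec.SR

/-! ## The admissible realisation from the two summed brackets -/

/-- **THE REALISATION.**  Scalars: quantised total `P`, its modulus total `Pa ≥ 0`, exact total `S`, modulus
total `L ≥ 0`, caps `γ̄, δ̄ ≥ 0`, constant `C ≥ 0`.  If `S - (1 - δ̄)(P + γ̄Pa) ≤ C·L` and
`(1 - δ̄)(P - γ̄Pa) - S ≤ C·L` then some admissible `(acc, c)` (`|acc - P| ≤ γ̄Pa`, `|c - acc| ≤ δ̄|acc|`) has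
`|c - S| ≤ C·L`: accumulate at the signed extreme nearer to `S`, then move the output toward `S`.
[cite: Higham2002ASNA, §3.1] -/
theorem realisation_of_brackets {P Pa S L γ δ C : ℚ} (hC : 0 ≤ C) (hγ0 : 0 ≤ γ) (hδ0 : 0 ≤ δ)
    (hPa : 0 ≤ Pa) (hL : 0 ≤ L)
    (h1 : S - (1 - δ) * (P + γ * Pa) ≤ C * L) (h2 : (1 - δ) * (P - γ * Pa) - S ≤ C * L) :
    ∃ acc c : ℚ, |acc - P| ≤ γ * Pa ∧ |c - acc| ≤ δ * |acc| ∧ |c - S| ≤ C * L := by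
  have hCL : 0 ≤ C * L := mul_nonneg hC hL
  have hγPa : 0 ≤ γ * Pa := mul_nonneg hγ0 hPa
  by_cases hhi : S ≤ P + γ * Pa
  · by_cases hlo : P - γ * Pa ≤ S
    · -- `S` itself is an admissible accumulation value: take `acc = c = S`
      refine ⟨S, S, ?_, ?_, ?_⟩
      · rw [abs_le]; constructor <;> linarith
      · rw [sub_self, abs_zero]; exact mul_nonneg hδ0 (abs_nonneg _)
      · rw [sub_self, abs_zero]; exact hCL
    · -- `S` below the accumulation band: accumulate LOW, then move the output down toward `S`
      push Not at hlo
      set A := P - γ * Pa with hA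
      refine ⟨A, max S (A - δ * |A|), ?_, ?_, ?_⟩
      · rw [hA, abs_le]; constructor <;> linarith
      · have hge : A - δ * |A| ≤ max S (A - δ * |A|) := le_max_right _ _
        have hle : max S (A - δ * |A|) ≤ A :=
          max_le hlo.le (by nlinarith [abs_nonneg A])
        rw [abs_le]; constructor <;> linarith
      · rcases le_total S (A - δ * |A|) with h | h
        · rw [max_eq_right h, abs_of_nonneg (by linarith)]
          have : δ * A ≤ δ * |A| := mul_le_mul_of_nonneg_left (le_abs_self A) hδ0
          linarith
        · rw [max_eq_left h, sub_self, abs_zero]; exact hCL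
  · -- `S` above the accumulation band: accumulate HIGH, then move the output up toward `S`
    push Not at hhi
    set A := P + γ * Pa with hA
    refine ⟨A, min S (A + δ * |A|), ?_, ?_, ?_⟩
    · rw [hA, abs_le]; constructor <;> linarith
    · have hle : min S (A + δ * |A|) ≤ A + δ * |A| := min_le_right _ _
      have hge : A ≤ min S (A + δ * |A|) :=
        le_min hhi.le (by nlinarith [abs_nonneg A])
      rw [abs_le]; constructor <;> linarith
    · rcases le_total (A + δ * |A|) S with h | h
      · rw [min_eq_right h, abs_of_nonpos (by linarith)]
        have : δ * -|A| ≤ δ * A := mul_le_mul_of_nonneg_left (neg_abs_le A) hδ0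
        linarith
      · rw [min_eq_left h, sub_self, abs_zero]; exact hCL

/-- **THE ONSET LAW, NO-WITNESS HALF, BLOCK FORM.**  Cells indexed by blocks `j` and positions `i`; if for
every block the two SUMMED bracket expressions `Σᵢ (s - (1 - δ̄)(p + γ̄|p|))` and `Σᵢ ((1 - δ̄)(p - γ̄|p|) - s)`
are at most `C·Σᵢ|s|` (`C, γ̄, δ̄ ≥ 0`), then SOME admissible realisation has `|c - ΣΣ s| ≤ C·ΣΣ|s|`: the
input is not an output-level witness against `C`.  (Cells of a block may share slack — the point of part (z).)
[cite: Higham2002ASNA, §3.1] -/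
theorem no_output_witness_of_block_bounds {B k : ℕ} (s p : Fin B → Fin k → ℚ) {γ δ C : ℚ}
    (hC : 0 ≤ C) (hγ0 : 0 ≤ γ) (hδ0 : 0 ≤ δ)
    (hblk : ∀ j, (∑ i, (s j i - (1 - δ) * (p j i + γ * |p j i|)) ≤ C * ∑ i, |s j i|) ∧
      (∑ i, ((1 - δ) * (p j i - γ * |p j i|) - s j i) ≤ C * ∑ i, |s j i|)) :
    ∃ acc c : ℚ, |acc - ∑ j, ∑ i, p j i| ≤ γ * ∑ j, ∑ i, |p j i| ∧ |c - acc| ≤ δ * |acc| ∧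
      |c - ∑ j, ∑ i, s j i| ≤ C * ∑ j, ∑ i, |s j i| := by
  have h1 : ∑ j, ∑ i, s j i - (1 - δ) * (∑ j, ∑ i, p j i + γ * ∑ j, ∑ i, |p j i|)
      ≤ C * ∑ j, ∑ i, |s j i| := by
    have h := sum_le_sum fun j (_ : j ∈ univ) => (hblk j).1
    simp only [sum_sub_distrib, sum_add_distrib, mul_add, ← mul_sum] at h
    linarith
  have h2 : (1 - δ) * (∑ j, ∑ i, p j i - γ * ∑ j, ∑ i, |p j i|) - ∑ j, ∑ i, s j i
      ≤ C * ∑ j, ∑ i, |s j i| := by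
    have h := sum_le_sum fun j (_ : j ∈ univ) => (hblk j).2
    simp only [sum_sub_distrib, mul_sub, ← mul_sum] at h
    linarith
  exact realisation_of_brackets hC hγ0 hδ0
    (sum_nonneg fun j _ => sum_nonneg fun i _ => abs_nonneg _)
    (sum_nonneg fun j _ => sum_nonneg fun i _ => abs_nonneg _) h1 h2

/-! ## Absorption: a small cell rides on a banded cell -/

/-- A cell `p' = r'·s'` with `0 ≤ r'` contributes at most `(1 + r')·|s'|` to either bracket expression
(`0 ≤ γ̄`, `0 ≤ δ̄ ≤ 1`). [folklore] -/
theorem small_cell_bounds {s' p' r' γ δ : ℚ} (hγ0 : 0 ≤ γ) (hδ0 : 0 ≤ δ) (hδ1 : δ ≤ 1)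
    (hr0 : 0 ≤ r') (hp : p' = r' * s') :
    s' - (1 - δ) * (p' + γ * |p'|) ≤ (1 + r') * |s'| ∧
      (1 - δ) * (p' - γ * |p'|) - s' ≤ (1 + r') * |s'| := by
  have hpabs : |p'| = r' * |s'| := by rw [hp, abs_mul, abs_of_nonneg hr0]
  have hA : 0 ≤ (1 - δ) * (1 + γ) * r' := mul_nonneg (mul_nonneg (by linarith) (by linarith)) hr0
  have hB : (1 - δ) * (1 - γ) * r' ≤ r' := by
    have h1 : (1 - δ) * (1 - γ) ≤ 1 := by nlinarith
    nlinarith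
  rcases le_or_gt 0 s' with hs | hs
  · rw [abs_of_nonneg hs] at hpabs ⊢
    rw [hpabs, hp]
    constructor
    · have e : s' - (1 - δ) * (r' * s' + γ * (r' * s')) = (1 - (1 - δ) * (1 + γ) * r') * s' := by ring
      rw [e]; exact mul_le_mul_of_nonneg_right (by linarith) hs
    · have e : (1 - δ) * (r' * s' - γ * (r' * s')) - s' = ((1 - δ) * (1 - γ) * r' - 1) * s' := by ring
      rw [e]; exact mul_le_mul_of_nonneg_right (by linarith) hs
  · have hs' : 0 ≤ -s' := by linarith
    rw [abs_of_neg hs] at hpabs ⊢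
    rw [hpabs, hp]
    constructor
    · have e : s' - (1 - δ) * (r' * s' + γ * (r' * -s')) = ((1 - δ) * (1 - γ) * r' - 1) * (-s') := by
        ring
      rw [e]; exact mul_le_mul_of_nonneg_right (by linarith) hs'
    · have e : (1 - δ) * (r' * s' - γ * (r' * -s')) - s' = (1 - (1 - δ) * (1 + γ) * r') * (-s') := by
        ring
      rw [e]; exact mul_le_mul_of_nonneg_right (by linarith) hs'

/-- **ABSORPTION.**  A banded cell `p = r·s`, `r ∈ [r_lo, r_hi]`, `0 ≤ r_lo`, and a small cell `p' = r'·s'`,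
`0 ≤ r' ≤ R'`, `|s'| ≤ ε·|s|`: if `(1 - γ̄)(1 - δ̄)·r_hi + (1 + R')ε ≤ 1 + C` and
`1 - (1 - δ̄)(1 + γ̄)·r_lo + (1 + R')ε ≤ C` (`C ≥ 0`, caps in `[0, 1]`) then the PAIR's summed bracket
expressions are at most `C·(|s| + |s'|)`. [cite: Higham2002ASNA, §3.1] -/
theorem absorb_cell_bounds {s p r rlo rhi s' p' r' R' ε γ δ C : ℚ} (hγ0 : 0 ≤ γ) (hγ1 : γ ≤ 1)
    (hδ0 : 0 ≤ δ) (hδ1 : δ ≤ 1) (hC : 0 ≤ C)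
    (hrlo : 0 ≤ rlo) (hlo : rlo ≤ r) (hhi : r ≤ rhi) (hp : p = r * s)
    (hr0 : 0 ≤ r') (hr1 : r' ≤ R') (hp' : p' = r' * s') (hε : |s'| ≤ ε * |s|)
    (hup : (1 - γ) * (1 - δ) * rhi + (1 + R') * ε ≤ 1 + C)
    (hdn : 1 - (1 - δ) * (1 + γ) * rlo + (1 + R') * ε ≤ C) :
    s - (1 - δ) * (p + γ * |p|) + (s' - (1 - δ) * (p' + γ * |p'|)) ≤ C * (|s| + |s'|) ∧
      (1 - δ) * (p - γ * |p|) - s + ((1 - δ) * (p' - γ * |p'|) - s') ≤ C * (|s| + |s'|) := by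
  obtain ⟨h1, h2⟩ := onset_cell_bounds (C := C - (1 + R') * ε) hγ0 hγ1 hδ1 hrlo hlo hhi hp
    (by linarith) (by linarith)
  obtain ⟨h1', h2'⟩ := small_cell_bounds hγ0 hδ0 hδ1 hr0 hp'
  have hs0 : 0 ≤ |s| := abs_nonneg _
  have hs0' : 0 ≤ |s'| := abs_nonneg _
  have hk : (1 + r') * |s'| ≤ (1 + R') * ε * |s| :=
    calc (1 + r') * |s'| ≤ (1 + R') * |s'| := mul_le_mul_of_nonneg_right (by linarith) hs0'
      _ ≤ (1 + R') * (ε * |s|) := mul_le_mul_of_nonneg_left hε (by linarith)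
      _ = (1 + R') * ε * |s| := by ring
  have hCs' : 0 ≤ C * |s'| := mul_nonneg hC hs0'
  have e : (C - (1 + R') * ε) * |s| + (1 + R') * ε * |s| = C * |s| := by ring
  constructor
  · nlinarith
  · nlinarith

/-! ## The two sliver rungs of E4M3 -/

/-- Every rational in `(13/1024, 15/1024)` rounds to `7/512 = 14/1024` in E4M3 (RNE): the endpoints are the
midpoints to the neighbouring values `12/1024` and `16/1024`. [folklore] -/
theorem toRat_roundNE_E4M3_eq_7_512 {y : ℚ} (h1 : 13 / 1024 < y) (h2 : y < 15 / 1024) :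
    (roundNE E4M3 y).toRat = 7 / 512 := by
  have hlo : (roundNE E4M3 (3 / 256)).toRat = 3 / 256 := by decide +kernel
  have hmid : (roundNE E4M3 (7 / 512)).toRat = 7 / 512 := by decide +kernel
  rcases le_or_gt y (7 / 512) with hy | hy
  · -- `(13/1024, 7/512]`: the upper half of the bracket `[12/1024, 14/1024]`
    have hall : ((all E4M3).all fun z => decide (z.toRat ≤ 3 / 256 ∨ 7 / 512 ≤ z.toRat)) = true := by
      decide +kernel
    have hgap : ∀ z : MiniFloat E4M3,
        z.toRat ≤ (roundNE E4M3 (3 / 256)).toRat ∨ (roundNE E4M3 (3 / 256)).toRat + 1 / 512 ≤ z.toRat := by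
      intro z
      have hz := of_decide_eq_true (forall_of_all_all hall z)
      rw [hlo]
      rcases hz with hz | hz
      · exact Or.inl hz
      · exact Or.inr (by linarith)
    have hu : (roundNE E4M3 (7 / 512)).toRat = (roundNE E4M3 (3 / 256)).toRat + 1 / 512 := by
      rw [hlo, hmid]; norm_num
    have key := forall_lt_of_mem_high (x := y) hu hgap (by rw [hlo]; linarith) (by rw [hlo]; linarith)
    rw [hmid] at key
    exact toRat_roundNE_eq_of_forall_lt ⟨roundNE E4M3 (7 / 512), hmid⟩ key
  · -- `[7/512, 15/1024)`: the lower half of the bracket `[14/1024, 16/1024]`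
    have hall : ((all E4M3).all fun z => decide (z.toRat ≤ 7 / 512 ∨ 1 / 64 ≤ z.toRat)) = true := by
      decide +kernel
    have hgap : ∀ z : MiniFloat E4M3,
        z.toRat ≤ (roundNE E4M3 (7 / 512)).toRat ∨ (roundNE E4M3 (7 / 512)).toRat + 1 / 512 ≤ z.toRat := by
      intro z
      have hz := of_decide_eq_true (forall_of_all_all hall z)
      rw [hmid]
      rcases hz with hz | hz
      · exact Or.inl hz
      · exact Or.inr (by linarith)
    have key := forall_lt_of_mem_low (x := y) hgap (by rw [hmid]; linarith) (by rw [hmid]; linarith)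
    rw [hmid] at key
    exact toRat_roundNE_eq_of_forall_lt ⟨roundNE E4M3 (7 / 512), hmid⟩ key

/-- The CLOSED first rung: every rational in `[15/1024, 1/64]` rounds to `1/64` (the tie `15/1024` goes to the
even neighbour `1/64 = 2⁻⁶`). [folklore] -/
theorem toRat_roundNE_E4M3_eq_inv64' {y : ℚ} (h1 : 15 / 1024 ≤ y) (h2 : y ≤ 1 / 64) :
    (roundNE E4M3 y).toRat = 1 / 64 := by
  rcases eq_or_lt_of_le h1 with h | h
  · rw [← h]; decide +kernel
  · exact toRat_roundNE_E4M3_eq_inv64 h h2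

/-! ## The MX-E4M3 (ceil) element trichotomy -/

/-- **NORMAL OR SMALL** (no class hypothesis): every MX-E4M3-ceil element is `ρ·v` with `16/17 ≤ ρ ≤ 18/17`
(normal or zero element: relative error `≤ 1/17`), or it is a nonzero SLIVER element, `|v|/X < 1/64`, hence
`14336·|v| < 224·X < blockMax V` (the ceil scale is minimal: `448·X < 2·blockMax V`).
[cite: RouhaniEtAl2023MX, §5.1] -/
theorem mxCeil_normal_or_small {k : ℕ} (V : Fin k → ℚ) (i : Fin k) :
    (∃ ρ : ℚ, 16 / 17 ≤ ρ ∧ ρ ≤ 18 / 17 ∧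
      ceilScale E4M3 V * (roundNE E4M3 (V i / ceilScale E4M3 V)).toRat = ρ * V i) ∨
    (V i ≠ 0 ∧ |V i| / ceilScale E4M3 V < 1 / 64 ∧ 14336 * |V i| < blockMax V) := by
  have hM : E4M3.maxRat = 448 := by decide +kernel
  have hM0 : 0 < E4M3.maxRat := by rw [hM]; norm_num
  by_cases hVi : V i = 0
  · left
    refine ⟨1, by norm_num, by norm_num, ?_⟩
    rw [hVi, scaled_zero, mul_zero]
  have hpos : 0 < |V i| := abs_pos.mpr hVi
  have hX : 0 < ceilScale E4M3 V := ceilScale_pos E4M3 V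
  by_cases hn : 1 / 64 ≤ |V i| / ceilScale E4M3 V
  · -- normal element: relative error `≤ 1/17`
    left
    have h := scaled_rel_error_le E4M3 hX (by rw [e4m3_envelope_constants.2.2.2.2.1]; exact hn)
      (mxCeil_scaled_le_maxRat E4M3 V i hM0)
    rw [e4m3_envelope_constants.1] at h
    have hρ : |ceilScale E4M3 V * (roundNE E4M3 (V i / ceilScale E4M3 V)).toRat / V i - 1| ≤ 1 / 17 := by
      rw [show ceilScale E4M3 V * (roundNE E4M3 (V i / ceilScale E4M3 V)).toRat / V i - 1
          = (ceilScale E4M3 V * (roundNE E4M3 (V i / ceilScale E4M3 V)).toRat - V i) / V i by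
            field_simp, abs_div, div_le_iff₀ hpos]
      exact h
    obtain ⟨hρ1, hρ2⟩ := abs_le.mp hρ
    refine ⟨ceilScale E4M3 V * (roundNE E4M3 (V i / ceilScale E4M3 V)).toRat / V i, by linarith,
      by linarith, ?_⟩
    rw [div_mul_cancel₀ _ hVi]
  · -- sliver element
    right
    have h2 : |V i| / ceilScale E4M3 V < 1 / 64 := not_le.mp hn
    have hB : 0 < blockMax V := lt_of_lt_of_le hpos (abs_le_blockMax V i)
    have hlt := ceilScale_mul_maxRat_lt_two_mul hM0 hB
    rw [hM] at hlt
    have hvX : |V i| < ceilScale E4M3 V / 64 := by rw [div_lt_iff₀ hX] at h2; linarith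
    exact ⟨hVi, h2, by linarith⟩

/-- An element of MAXIMAL MODULUS in its block is normal (or zero): `q̂ = ρ·v`, `16/17 ≤ ρ ≤ 18/17` — for every
`κ`. [cite: RouhaniEtAl2023MX, §5.1] -/
theorem mxCeil_ratio_of_max {k : ℕ} (V : Fin k → ℚ) (i : Fin k) (hi : ∀ i', |V i'| ≤ |V i|) :
    ∃ ρ : ℚ, 16 / 17 ≤ ρ ∧ ρ ≤ 18 / 17 ∧
      ceilScale E4M3 V * (roundNE E4M3 (V i / ceilScale E4M3 V)).toRat = ρ * V i := by
  rcases mxCeil_normal_or_small V i with h | ⟨_, _, h⟩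
  · exact h
  · exfalso
    have hB : blockMax V = |V i| := blockMax_eq_of_forall_le hi rfl
    rw [hB] at h
    linarith [abs_nonneg (V i)]

/-- **MX-E4M3 RATIO BAND WITH BOTH SLIVER RUNGS.**  On a block of `C(κ)` with `κ ≤ 229376/13` every
MX-E4M3-ceil element is `ρ·v` with `ρ_lo ≤ ρ ≤ R`, for any `ρ_lo ≤ 16/17` with `ρ_lo ≤ 14/15` once
`229376/15 < κ`, and any `R ≥ 18/17` with `min(κ/14336, 16/15) ≤ R` and `κ/16384 ≤ R`: a sliver element has
`13/1024 < |v|/X < 1/64` (from `224·X < κ|v|`); on the first rung `[15/1024, 1/64)` it becomes `X/64` (ratio in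
`[1, 16/15]`, `< κ/14336`), on the second rung `(13/1024, 15/1024)` — reachable only for `κ > 229376/15` — it
becomes `7X/512` (ratio in `(14/15, κ/16384)`). [cite: RouhaniEtAl2023MX, §5.1] -/
theorem mxCeil_ratio_band_two_rungs {k : ℕ} (V : Fin k → ℚ) (i : Fin k) {κ ρlo R : ℚ}
    (hκ : V i = 0 ∨ blockMax V ≤ κ * |V i|) (hκM : κ ≤ 229376 / 13)
    (hρ1 : ρlo ≤ 16 / 17) (hρ2 : 229376 / 15 < κ → ρlo ≤ 14 / 15)
    (hR : 18 / 17 ≤ R) (hR1 : min (κ / 14336) (16 / 15) ≤ R) (hR2 : κ / 16384 ≤ R) :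
    ∃ ρ : ℚ, ρlo ≤ ρ ∧ ρ ≤ R ∧
      ceilScale E4M3 V * (roundNE E4M3 (V i / ceilScale E4M3 V)).toRat = ρ * V i := by
  rcases mxCeil_normal_or_small V i with ⟨ρ, h1, h2, h⟩ | ⟨hVi, h2, hsm⟩
  · exact ⟨ρ, by linarith, by linarith, h⟩
  have hM : E4M3.maxRat = 448 := by decide +kernel
  have hκ' : blockMax V ≤ κ * |V i| := hκ.resolve_left hVi
  have hpos : 0 < |V i| := abs_pos.mpr hVi
  have hX : 0 < ceilScale E4M3 V := ceilScale_pos E4M3 V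
  have hB : 0 < blockMax V := lt_of_lt_of_le hpos (abs_le_blockMax V i)
  have hlt := ceilScale_mul_maxRat_lt_two_mul (by rw [hM]; norm_num) hB
  rw [hM] at hlt
  have h224 : ceilScale E4M3 V * 224 < κ * |V i| := by linarith
  have hy13 : 13 / 1024 < |V i| / ceilScale E4M3 V := by
    rw [lt_div_iff₀ hX]
    have h1 : κ * |V i| ≤ 229376 / 13 * |V i| := mul_le_mul_of_nonneg_right hκM hpos.le
    linarith
  by_cases hy15 : 15 / 1024 ≤ |V i| / ceilScale E4M3 V
  · -- first rung: value `X/64`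
    have hq : (roundNE E4M3 (|V i| / ceilScale E4M3 V)).toRat = 1 / 64 :=
      toRat_roundNE_E4M3_eq_inv64' hy15 h2.le
    have hvX : |V i| < ceilScale E4M3 V / 64 := by rw [div_lt_iff₀ hX] at h2; linarith
    have hvX' : 15 / 1024 * ceilScale E4M3 V ≤ |V i| := by rw [le_div_iff₀ hX] at hy15; linarith
    refine ⟨ceilScale E4M3 V / 64 / |V i|, ?_, ?_, ?_⟩
    · rw [le_div_iff₀ hpos]
      have : ρlo * |V i| ≤ 16 / 17 * |V i| := mul_le_mul_of_nonneg_right hρ1 hpos.le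
      linarith
    · have hle1 : ceilScale E4M3 V / 64 / |V i| ≤ κ / 14336 := by
        rw [div_le_iff₀ hpos]; linarith
      have hle2 : ceilScale E4M3 V / 64 / |V i| ≤ 16 / 15 := by
        rw [div_le_iff₀ hpos]; linarith
      exact le_trans (le_min hle1 hle2) hR1
    · rcases lt_or_gt_of_ne hVi with hneg | hposv
      · have e : V i / ceilScale E4M3 V = -(|V i| / ceilScale E4M3 V) := by
          rw [abs_of_neg hneg]; ring
        rw [e, toRat_roundNE_neg, hq, abs_of_neg hneg]
        field_simp
      · rw [abs_of_pos hposv] at hq ⊢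
        rw [hq]
        field_simp
  · -- second rung: value `7X/512`; forces `κ > 229376/15`
    have hy15' : |V i| / ceilScale E4M3 V < 15 / 1024 := not_le.mp hy15
    have hv15 : |V i| < 15 / 1024 * ceilScale E4M3 V := by rw [div_lt_iff₀ hX] at hy15'; linarith
    have hκ2 : 229376 / 15 < κ := by
      by_contra hk
      push Not at hk
      have : κ * |V i| ≤ 229376 / 15 * |V i| := mul_le_mul_of_nonneg_right hk hpos.le
      linarith
    have hρ14 := hρ2 hκ2
    have hq : (roundNE E4M3 (|V i| / ceilScale E4M3 V)).toRat = 7 / 512 :=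
      toRat_roundNE_E4M3_eq_7_512 hy13 hy15'
    refine ⟨ceilScale E4M3 V * (7 / 512) / |V i|, ?_, ?_, ?_⟩
    · rw [le_div_iff₀ hpos]
      have : ρlo * |V i| ≤ 14 / 15 * |V i| := mul_le_mul_of_nonneg_right hρ14 hpos.le
      linarith
    · refine le_trans ?_ hR2
      rw [div_le_iff₀ hpos]; linarith
    · rcases lt_or_gt_of_ne hVi with hneg | hposv
      · have e : V i / ceilScale E4M3 V = -(|V i| / ceilScale E4M3 V) := by
          rw [abs_of_neg hneg]; ring
        rw [e, toRat_roundNE_neg, hq, abs_of_neg hneg]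
        field_simp
      · rw [abs_of_pos hposv] at hq ⊢
        rw [hq]
        field_simp

/-! ## Blocks of length 2 -/

/-- A block of length 2 has an element of maximal modulus. [folklore] -/
theorem exists_forall_abs_le_two (V : Fin 2 → ℚ) : ∃ i, ∀ i', |V i'| ≤ |V i| := by
  rcases le_total |V 0| |V 1| with h | h
  · exact ⟨1, Fin.forall_fin_two.mpr ⟨h, le_rfl⟩⟩
  · exact ⟨0, Fin.forall_fin_two.mpr ⟨le_rfl, h⟩⟩

end Summit.Ventures.CertifiedArithmetic.LowPrec.GemmEnvelope
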